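import Literature.Analysis.FluidPDE.ForwardDSSExistenceUniversalReduction
import Literature.Analysis.FluidPDE.PeriodicLerayMollifiedAssembly
import HarnessLib

/-!
# Chae–Wolf 2018, Theorem 1.4: the discharge of `chaeWolf2018_dss_existence`

Analysis/FluidPDE proof file (theorems only; no definitions, no named facts, nothing restated)
discharging the named fact `Literature.Analysis.FluidPDE.chaeWolf2018_dss_existence`
(`SelfSimilarLiouville.lean`):

> **Chae–Wolf, Ann. Inst. H. Poincaré C Anal. Non Linéaire 35 (2018) 1019–1039 =
> arXiv:1610.01386, Theorem 1.4** (with Definition 1.2). For any `λ`-DSS initial datum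
> `u₀ ∈ L²_{loc,σ}(ℝ³)`, `λ > 1`, there exists at least one local Leray solution (with projected
> pressure) of the Navier–Stokes equations which is `λ`-discretely self-similar.

The tree proves the stronger theorem of Bradshaw–Tsai (Analysis & PDE 12 (2019), Thm 1.2: a
`λ`-DSS *suitable* local energy solution for every such datum; "a slight refinement of the main
result of [Chae–Wolf]", loc. cit., Comments on Thm 1.2) along its printed proof — Lemma 4.1,
Prop. 3.1 (for every `λ`-DSS local Leray solution, via the Kang–Miura–Tsai pressure expansion and
Stein's `L^p` bound), §4.3 — over [BT1] = Bradshaw–Tsai, Ann. Henri Poincaré 18 (2017), Thm 1.2,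
whose last ingredient is the Galerkin construction of periodic weak solutions of the mollified
perturbed Leray system (`bradshawTsai2017_thm_2_4_mollified`, [BT1] Lemma 2.6 and proof of
Thm 2.4). All of this is composed in the accepted
`chaeWolf2018_dss_existence_of_thm_2_4_mollified` (`ForwardDSSExistenceUniversalReduction.lean`);
this file feeds it the discharge `bradshawTsai2017_thm_2_4_mollified_holds`.

Chae–Wolf's own proof (§2: localised energy estimates for the linearised problem with DSS drift,
Thm 2.2; §3: Schauder's fixed point theorem for the DSS-mollified system and the limit `ε → 0`)
is not the road taken: it needs the Stokes pressure projection on `C²` domains, linear parabolic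
existence theory and Schauder's theorem, none of which the tree has, whereas every step of the
Bradshaw–Tsai road is a theorem of the tree.

## References

* D. Chae, J. Wolf, *Existence of discretely self-similar solutions to the Navier–Stokes
  equations for initial value in `L²_loc(ℝ³)`*, Ann. Inst. H. Poincaré C Anal. Non Linéaire 35
  (2018) 1019–1039 = arXiv:1610.01386, Def. 1.2, Thm 1.4 [ChaeWolf2018].
* Z. Bradshaw, T.-P. Tsai, Analysis & PDE 12 (2019) 1943–1962 = arXiv:1801.08060, Thm 1.2 and
  Comments on Thm 1.2 [BradshawTsai2019].
* Z. Bradshaw, T.-P. Tsai, Ann. Henri Poincaré 18 (2017) 1095–1119 = arXiv:1510.07504, Thm 1.2,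
  Thm 2.4, Lemma 2.6 [BradshawTsai2017AHP].
-/

noncomputable section

namespace Literature.Analysis.FluidPDE

/-- **Chae–Wolf 2018, Theorem 1.4** (discharge of `chaeWolf2018_dss_existence`): every weakly
divergence free `λ`-DSS datum `u₀ ∈ L²_loc(ℝ³)`, `λ > 1`, is the datum of a global `λ`-DSS weak
solution of the Navier–Stokes equations in the local energy class with the datum attained in
`L²_loc` — obtained from Bradshaw–Tsai 2019, Thm 1.2 (proved in the tree over [BT1]'s Galerkin
construction `bradshawTsai2017_thm_2_4_mollified_holds`) through the accepted
`chaeWolf2018_dss_existence_of_thm_2_4_mollified`. [cite: ChaeWolf2018, Thm 1.4 (with Def 1.2); BradshawTsai2019, Thm 1.2 and Comments on Thm 1.2] -/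
theorem chaeWolf2018_dss_existence_holds : chaeWolf2018_dss_existence :=
  chaeWolf2018_dss_existence_of_thm_2_4_mollified bradshawTsai2017_thm_2_4_mollified_holds

end Literature.Analysis.FluidPDE

end
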